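/-
Copyright (c) 2026 the pub-hodgecm-mathlib formalisation cell (harness21).  Prover seat hodgecm-mathlib-LH4-p08 (g12), req620 Track A «(D-RAM) FOUR-FRAME» squad
(STAGE-1b, row (2) of the piece `f_{T₊}`, the (β₂) road (R-36); the K6 road (A2∕A5 of K6 DESK WORD #17) and the (OFF) MIX-HI wall (β₂ WORDs #34∕#36∕#41: «ONE affine ω-sum per
cell over the digits ON the sphere»): «THE SPHERE LABEL SUMS» — the affine label character summed over ONE digit SPHERE, in the socket's digit currency, all three regimes), 2026-09-05.
-/
import Summits.HodgeConjecture.HodgeConjecture.Theorems.F0P3cDyRamWindowLabelSumVanishes   -- ★ p864489 (LH4-p11 (g11)) K6-(g): `sum_normSign_affine_filterBall_eq_zero`;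
                                                                                            -- brings ★ Lit `normSign_eq_of_near`, `IsRamifiedQuadraticDatum`, `normSign`
import Literature.NumberTheory.LocalFields.WildQuadraticDatumNormOneQuotient                -- ★ Lit `two_le_of_v_two_lt_one` (a wild place has `2 ≤ d`)
import HarnessLib

/-!
# Crux `H413`, line LH4 «(D-RAM) FOUR-FRAME» — STAGE-1b, row (2), the (β₂) road (R-36): «THE SPHERE LABEL SUMS» — `Σ_{V ∈ Rd, |V| = |ϖ|^{2e}} ω(α₁ + γ₁·V)` over ONE digit
# sphere of a complete irredundant digit system, in the three regimes of the image sphere `|u − α₁| = |ϖ|^{2(c+e)}`: ZERO (`c + e + 2 ≤ d`), CONDUCTOR (`c + e + 1 = d`), FAR (`d ≤ c + e`)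

Cell `hodgecm-mathlib` (D-0151), FLOOR 0, crux item H413 = `stmt-HodgeConjecture-24833`, route of record `HCCMUnconditional`; squad F0∕P3c∕LH4; lane
`--supports stmt-HodgeConjecture-24833 --as helper` (count-neutral; pays NO tier-0 row).  THEOREMS ONLY (no `def`, no instance, no notation, no `sorry`, default heartbeats);
★-only imports; states NO law.  ONE-FIELD local arithmetic of a ramified quadratic datum `(σ, ϖ; d, t)` on a complete `K` with finite residue field (`F = K^σ` the fixed elements,
`|ϖ_F| = |ϖ|²`, `ω = normSign σ`, `U_F(k)` = fixed units `u` with `|u − 1| ≤ |ϖ|^k`); nothing about lattices, no chart object, no second field.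

WHAT.  The per-cell laws of the (β₂) road (K6-0 ★ p864195, F1b ★ p864627, the MIX-HI product balances ‹PRODBAL-L∕U∕D›) evaluate, cell by cell, the affine label character
`V ↦ ω(α₁ + γ₁·V)` (`α₁, γ₁` σ-fixed, `|α₁| = 1`, `|γ₁| = |ϖ|^{2c}`) over the digits of ONE cell, and a cell of a chart is a digit SPHERE `|V| = |ϖ|^{2e}` (or the innermost ball).
★ p864489 gives the BALL sums (`Σ_{|V| ≤ |ϖ|^{2e}} ω = 0` for `1 ≤ c + e`, `c + e + 1 ≤ d`); ★ LH4-p14 `…BinaryNormFormFixedSums` gives shell sums over a unit system at the fixed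
resolution `2(d − j)`.  THIS FILE states the SPHERE sums in the SOCKET's digit currency (`Rd hRd1 hRd2 hRd3` = ONE complete irredundant system of σ-fixed integral digits modulo
`|ϖ|^n`, ★ p863833 ∕ ★ p864489 §3 ∕ ★ p864509 letters) at a free resolution, for a centre of ANY valuation (MIX-HI lead LH4-p13 (g10) 02:49:34Z: the MIX payer's digit set is a
VALUE sphere `|α₁ + γ₁V| = |c_{ℓ₀}|`, possibly a cancellation sphere, and `ω` is read on the unit part):
* §0 `normSign_norm_mul'`, `normSign_mul_varpiF_pow_inv`, `normSign_mul_varpiF_pow` — READING `ω` ON THE UNIT PART is free: `ω(x·ϖ_F^{∓ℓ}) = ω(x)` for ANY `x` (`ϖ_F^ℓ = N(ϖ^ℓ)`);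
  `sum_normSign_affine_eq_sum_rescale` + `rescale_letters` — a centre whose valuation `|ϖ|^{2a}` DOMINATES the digit scale (`|γ₁| = |ϖ|^{2a+2c}`) rescales to a unit centre (PART A).
PART A — UNIT CENTRE, DIGIT SPHERES `|V| = |ϖ|^{2e}`:
* §1 `sum_filterBall_eq_sum_filterSphere_add_sum_filterBall_succ` — THE SHELL SPLIT `Σ_{|V| ≤ |ϖ|^{2e}} φ = Σ_{|V| = |ϖ|^{2e}} φ + Σ_{|V| ≤ |ϖ|^{2(e+1)}} φ` for any summand
  (fixed non-zero digits have EVEN valuation).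
* §2 FAR REGIME `d ≤ c + e`: `sum_normSign_affine_eq_card_mul_of_far` — over ANY finite set of fixed digits in the ball `|V| ≤ |ϖ|^{2e}` every term is `ω(α₁)` (the values lie in
  `α₁·U_F(2d)`, ★ Lit `normSign_eq_of_near`), so the sum is `#S · ω(α₁)`; corollaries `…filterBall…`, `…filterSphere…`.
* §3 ZERO REGIME `1 ≤ c + e`, `c + e + 2 ≤ d`: **`sum_normSign_affine_filterSphere_eq_zero`** — `Σ_{V ∈ Rd.filter (|V| = |ϖ|^{2e})} ω(α₁ + γ₁V) = 0` (★ p864489 §3 at `e` and at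
  `e + 1`, and §1), resolution floor `2d − 1 ≤ 2c + n`, `2(e + 1) ≤ n`.
* §4 CONDUCTOR SPHERE `c + e + 1 = d`: **`sum_normSign_affine_filterSphere_conductor`** — `Σ_{V ∈ Rd.filter (|V| = |ϖ|^{2e})} ω(α₁ + γ₁V) = −(#(Rd.filter (|V| ≤ |ϖ|^{2(e+1)})) · ω(α₁))`
  (★ p864489 §3 at `e` gives `0` for the ball; the inner ball is FAR, §2; `1 ≤ c + e` is automatic from `2 ≤ d` at a wild place, ★ Lit `two_le_of_v_two_lt_one`).
PART B — CENTRE INSIDE THE DIGIT BALL (`|α₁| ≤ |γ₁| = |ϖ|^{2c}`, non-unit centre allowed), VALUE SPHERES `|α₁ + γ₁V| = |ϖ|^{2ℓ}` (cancellation spheres):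
* §5 (B1) `affine_image_repr_valueBall` — `W := α₁ + γ₁V` carries `Rd` onto a complete irredundant system of the fixed ball `|W| ≤ |ϖ|^{2c}` modulo `|ϖ|^{2c+n}` (`|γ₁|`'s exponent is
  absorbed in the resolution); (B2) **`sum_normSign_affine_filterValueSphere_eq_zero`** — `Σ_{V ∈ Rd.filter (|α₁ + γ₁V| = |ϖ|^{2ℓ})} ω(α₁ + γ₁V) = 0` for ANY level `ℓ` as soon as the
  RELATIVE resolution on the value sphere reaches the conductor, `2d − 1 + 2ℓ ≤ 2c + n` (the unit parts `W·ϖ_F^{−ℓ}` form a complete irredundant system of ALL fixed units modulo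
  `𝔭^{2c+n−2ℓ}`; ★ Lit `sum_normSign_repr_eq_zero`).  REGIME BOUNDARY in `(n, ℓ, d)`: for `2c + n − 2ℓ ≤ 2d − 2` the sum over a representative system is NOT a function of the data
  (`ω` is non-constant on `U_F(2c+n−2ℓ)`-classes, ★ Lit `exists_fixed_unit_not_norm_v_sub_one_le`) — a 0-centred sphere has no one-field «conductor»∕«far» regime; finer digits must
  then come from the lattice half.
Reading: TOP chart of a row (`|γ₁| = 1`, `c = 0`): cell `i ≥ 1` below the top is the sphere `e = N − i`; INSIDE chart (`|γ₁| = |ϖ|²`, `c = 1`): cell `i` is the sphere `e = N − 1 − i`;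
the conductor sphere is the FLIP cell, the far spheres are ONE-CLASS cells, the zero spheres are BALANCED cells — per literal the K6-0 law multiplies these by the cell's density and sign.
WHAT IS NOT CLAIMED: any per-cell law, any chart letter, any census identity, the per-literal (labelled-digit) sums; (β₂), ‹CORE›∕‹CORE-ODD›, ‹PRODBAL-L∕U∕D› remain HYPOTHESES of
their consumers.
HONEST LABEL.  Count-neutral local arithmetic; nothing printed is asserted; no census law is stated; `HC_CM` is proved only modulo the 7 printed citations (2 remaining named
inputs: hLiu418 = `stmt-HodgeConjecture-24832`, h413 = `stmt-HodgeConjecture-24833`) until rung 0 closes.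
## References
* [Serre1979] J.-P. Serre, *Local Fields*, GTM 67 (1979): Ch. V §3 Prop. 5, Cor. 2–3 pp. 84–86 (norm groups of a totally ramified quadratic extension; the conductor), Ch. XV §2
  (the conductor via `U^{(n)}`; a non-trivial character sums to zero over the cosets on which it is non-trivial and is constant on the cosets of its conductor group).
* [NeukirchANT1999] J. Neukirch, *Algebraic Number Theory* (1999): Ch. V (1.3) (local norm index two).
* [Kottwitz1986BaseChangeUnits] R. E. Kottwitz, *Base change for unit elements of Hecke algebras*, Compositio Math. 60 (1986): §1 pp. 240–241 (cell-by-cell lattice bookkeeping).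
* [Rogawski1990] J. D. Rogawski, *Automorphic Representations of Unitary Groups in Three Variables*, Ann. of Math. Stud. 123 (1990): §4.9 Prop. 4.9.1 (b) p. 55 (the labelled census).
-/

set_option autoImplicit false

noncomputable section

namespace Summit.HodgeConjecture.HodgeConjecture.Cruxes.H413.F0P3cDyRamSphereLabelSums

open WithZero Finset
open scoped Valued
open Literature.NumberTheory.Automorphic.UnitaryThreeFourFrame (IsRamifiedQuadraticDatum normSign normSign_of_isNorm normSign_of_not_isNorm)
open Literature.NumberTheory.LocalFields.WildQuadraticDatum (normSign_eq_of_near sum_normSign_repr_eq_zero two_le_of_v_two_lt_one)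
open Summit.HodgeConjecture.HodgeConjecture.Cruxes.H413.F0P3cDyRamWindowLabelSumVanishes (sum_normSign_affine_filterBall_eq_zero)

variable {K : Type} [Field K] [Valued K ℤᵐ⁰] {σ : K →+* K} {ϖ : K} {d t : ℕ}

/-! ## §0 Reading `ω` on the unit part: a norm factor does not change the norm class (no hypothesis on the argument) -/

omit [Valued K ℤᵐ⁰] in
/-- **`ω(z·σz·x) = ω(x)`** for `z ≠ 0` and ANY `x` (`x` is a norm iff `N(z)·x` is).  (Public twin of ★ `UnitaryThreeFourFrameFamilyExists`' private `normSign_norm_mul`.)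
[cite: Serre1979, Ch. V §3 Cor. 3 pp. 84–86] -/
theorem normSign_norm_mul' {z : K} (hz : z ≠ 0) (x : K) : normSign σ (z * σ z * x) = normSign σ x := by
  have hiff : (∃ y : K, y * σ y = z * σ z * x) ↔ ∃ y : K, y * σ y = x := by
    constructor
    · rintro ⟨y, hy⟩
      refine ⟨y / z, ?_⟩
      have hσz : σ z ≠ 0 := (map_ne_zero σ).2 hz
      rw [map_div₀, div_mul_div_comm, hy]
      field_simp
    · rintro ⟨y, hy⟩
      exact ⟨z * y, by rw [map_mul, ← hy]; ring⟩
  by_cases h : ∃ y : K, y * σ y = x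
  · rw [normSign_of_isNorm σ h, normSign_of_isNorm σ (hiff.2 h)]
  · rw [normSign_of_not_isNorm σ h, normSign_of_not_isNorm σ (fun h' => h (hiff.1 h'))]

omit [Valued K ℤᵐ⁰] in
/-- **READING `ω` ON THE UNIT PART: `ω(x·ϖ_F^{−ℓ}) = ω(x)`** (`ϖ_F = ϖσϖ`, `ϖ_F^ℓ = N(ϖ^ℓ)` is a norm; `ϖ ≠ 0`, ANY `x`).  So for a fixed `W` on the sphere `|W| = |ϖ|^{2ℓ}` the norm class
of its unit part `W·ϖ_F^{−ℓ}` IS `ω(W)`. [cite: Serre1979, Ch. V §3 Cor. 3 pp. 84–86] -/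
theorem normSign_mul_varpiF_pow_inv (hϖ0 : ϖ ≠ 0) (ℓ : ℕ) (x : K) :
    normSign σ (x * ((ϖ * σ ϖ) ^ ℓ)⁻¹) = normSign σ x := by
  have hz : (ϖ ^ ℓ)⁻¹ ≠ 0 := inv_ne_zero (pow_ne_zero _ hϖ0)
  have e : x * ((ϖ * σ ϖ) ^ ℓ)⁻¹ = (ϖ ^ ℓ)⁻¹ * σ (ϖ ^ ℓ)⁻¹ * x := by
    rw [map_inv₀, map_pow, mul_pow, mul_inv]; ring
  rw [e, normSign_norm_mul' hz]

omit [Valued K ℤᵐ⁰] in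
/-- **`ω(x·ϖ_F^ℓ) = ω(x)`** (`ϖ_F^ℓ = N(ϖ^ℓ)`; `ϖ ≠ 0`, ANY `x`). [cite: Serre1979, Ch. V §3 Cor. 3 pp. 84–86] -/
theorem normSign_mul_varpiF_pow (hϖ0 : ϖ ≠ 0) (ℓ : ℕ) (x : K) :
    normSign σ (x * (ϖ * σ ϖ) ^ ℓ) = normSign σ x := by
  rw [mul_comm x, mul_pow, ← map_pow]
  exact normSign_norm_mul' (pow_ne_zero _ hϖ0) x

omit [Valued K ℤᵐ⁰] in
/-- **RESCALING A DOMINATING CENTRE TO A UNIT**: `Σ_{V ∈ S} ω(α₁ + γ₁·V) = Σ_{V ∈ S} ω(α₁·ϖ_F^{−a} + (γ₁·ϖ_F^{−a})·V)` for any finite `S` and any `a` (termwise §0).  With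
`|α₁| = |ϖ|^{2a}`, `|γ₁| = |ϖ|^{2a+2c}` the rescaled letters `α₁' := α₁ϖ_F^{−a}`, `γ₁' := γ₁ϖ_F^{−a}` are fixed with `|α₁'| = 1`, `|γ₁'| = |ϖ|^{2c}` — so PART A below (unit centre)
covers every centre whose valuation DOMINATES the digit scale. [cite: Serre1979, Ch. V §3 Cor. 3 pp. 84–86] -/
theorem sum_normSign_affine_eq_sum_rescale (hϖ0 : ϖ ≠ 0) (α₁ γ₁ : K) (a : ℕ) (S : Finset K) :
    ∑ V ∈ S, normSign σ (α₁ + γ₁ * V) = ∑ V ∈ S, normSign σ (α₁ * ((ϖ * σ ϖ) ^ a)⁻¹ + γ₁ * ((ϖ * σ ϖ) ^ a)⁻¹ * V) := by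
  refine sum_congr rfl fun V _ => ?_
  rw [← normSign_mul_varpiF_pow_inv hϖ0 a (α₁ + γ₁ * V)]
  congr 1; ring

/-- **THE RESCALED LETTERS**: for fixed `α₁, γ₁` with `|α₁| = |ϖ|^{2a}`, `|γ₁| = |ϖ|^{2a+2c}` (datum: `v∘σ = v`, `|ϖ_F| = |ϖ|²`), the letters `α₁' := α₁ϖ_F^{−a}`, `γ₁' := γ₁ϖ_F^{−a}`
are fixed with `|α₁'| = 1`, `|γ₁'| = |ϖ|^{2c}` — the hypotheses of PART A. [cite: Serre1979, Ch. V §3 Prop. 5 pp. 84–86] -/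
theorem rescale_letters (hD : IsRamifiedQuadraticDatum σ ϖ d t) {α₁ γ₁ : K} (hσα₁ : σ α₁ = α₁) (hσγ₁ : σ γ₁ = γ₁)
    {a c : ℕ} (hα₁ : Valued.v α₁ = Valued.v ϖ ^ (2 * a)) (hγ₁ : Valued.v γ₁ = Valued.v ϖ ^ (2 * a + 2 * c)) :
    σ (α₁ * ((ϖ * σ ϖ) ^ a)⁻¹) = α₁ * ((ϖ * σ ϖ) ^ a)⁻¹ ∧ Valued.v (α₁ * ((ϖ * σ ϖ) ^ a)⁻¹) = 1 ∧
      σ (γ₁ * ((ϖ * σ ϖ) ^ a)⁻¹) = γ₁ * ((ϖ * σ ϖ) ^ a)⁻¹ ∧ Valued.v (γ₁ * ((ϖ * σ ϖ) ^ a)⁻¹) = Valued.v ϖ ^ (2 * c) := by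
  obtain ⟨hσ, hvσ, hϖ, -, -, -, -⟩ := id hD
  have hvϖ0 : Valued.v ϖ ≠ 0 := by rw [hϖ]; exact exp_ne_zero
  have hσπ : σ ((ϖ * σ ϖ) ^ a) = (ϖ * σ ϖ) ^ a := by rw [map_pow, map_mul, hσ, mul_comm (σ ϖ) ϖ]
  have hvπ : Valued.v ((ϖ * σ ϖ) ^ a) = Valued.v ϖ ^ (2 * a) := by rw [map_pow, map_mul, hvσ, ← pow_two, ← pow_mul]
  have hπ0 : Valued.v ϖ ^ (2 * a) ≠ 0 := pow_ne_zero _ hvϖ0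
  refine ⟨by rw [map_mul, map_inv₀, hσα₁, hσπ], ?_, by rw [map_mul, map_inv₀, hσγ₁, hσπ], ?_⟩
  · rw [map_mul, map_inv₀, hvπ, hα₁, mul_inv_cancel₀ hπ0]
  · rw [map_mul, map_inv₀, hvπ, hγ₁, pow_add, mul_comm (Valued.v ϖ ^ (2 * a)), mul_assoc, mul_inv_cancel₀ hπ0, mul_one]

/-! ## §1 The shell split of a digit ball: sphere ⊔ next ball (fixed digits have even valuation) -/

/-- **THE SHELL SPLIT.**  Ramified quadratic datum (only `|ϖ| = exp(−1)` and the even-valuation clause are used); `Rd` a finite set of σ-fixed elements; any summand `φ`.  THEN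
`Σ_{V ∈ Rd, |V| ≤ |ϖ|^{2e}} φ V = Σ_{V ∈ Rd, |V| = |ϖ|^{2e}} φ V + Σ_{V ∈ Rd, |V| ≤ |ϖ|^{2(e+1)}} φ V`: a fixed `V` with `|V| ≤ |ϖ|^{2e}`, `|V| ≠ |ϖ|^{2e}` has `|V| ≤ |ϖ|^{2e+2}`
(even valuation), and `|ϖ|^{2e+2} < |ϖ|^{2e}` makes the two parts disjoint. [cite: Serre1979, Ch. V §3 Prop. 5, Cor. 2–3 pp. 84–86] -/
theorem sum_filterBall_eq_sum_filterSphere_add_sum_filterBall_succ (hD : IsRamifiedQuadraticDatum σ ϖ d t)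
    (Rd : Finset K) (hRdσ : ∀ V ∈ Rd, σ V = V) (e : ℕ) (φ : K → ℤ) :
    ∑ V ∈ Rd.filter (fun V => Valued.v V ≤ Valued.v ϖ ^ (2 * e)), φ V =
      ∑ V ∈ Rd.filter (fun V => Valued.v V = Valued.v ϖ ^ (2 * e)), φ V +
        ∑ V ∈ Rd.filter (fun V => Valued.v V ≤ Valued.v ϖ ^ (2 * (e + 1))), φ V := by
  classical
  obtain ⟨-, -, hϖ, hfix, -, -, -⟩ := id hD
  have hpow : ∀ k : ℕ, Valued.v ϖ ^ k = exp (-(k : ℤ)) := fun k => by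
    rw [hϖ, ← exp_nsmul, nsmul_eq_mul, mul_neg, mul_one]
  have hlt : Valued.v ϖ ^ (2 * (e + 1)) < Valued.v ϖ ^ (2 * e) := by
    rw [hpow, hpow, exp_lt_exp]; push_cast; omega
  -- a fixed digit of the ball off the sphere lies in the next ball
  have hdown : ∀ V ∈ Rd, Valued.v V ≤ Valued.v ϖ ^ (2 * e) → Valued.v V ≠ Valued.v ϖ ^ (2 * e) →
      Valued.v V ≤ Valued.v ϖ ^ (2 * (e + 1)) := by
    intro V hV hVle hVne
    by_cases hV0 : V = 0
    · rw [hV0, map_zero]; exact zero_le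
    obtain ⟨m, hm⟩ := hfix V (hRdσ V hV) hV0
    rw [hm, hpow, exp_le_exp]
    rw [hm, hpow, exp_le_exp] at hVle
    have hne : (2 * m : ℤ) ≠ -((2 * e : ℕ) : ℤ) := fun h => hVne (by rw [hm, hpow, h])
    push_cast at hVle hne ⊢
    omega
  rw [← sum_filter_add_sum_filter_not (Rd.filter (fun V => Valued.v V ≤ Valued.v ϖ ^ (2 * e))) (fun V => Valued.v V = Valued.v ϖ ^ (2 * e)),
    filter_filter, filter_filter]
  congr 1
  · refine sum_congr (Finset.ext fun V => ?_) fun _ _ => rfl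
    simp only [mem_filter]
    exact ⟨fun ⟨hV, _, hVe⟩ => ⟨hV, hVe⟩, fun ⟨hV, hVe⟩ => ⟨hV, hVe.le, hVe⟩⟩
  · refine sum_congr (Finset.ext fun V => ?_) fun _ _ => rfl
    simp only [mem_filter]
    constructor
    · rintro ⟨hV, hVle, hVne⟩
      exact ⟨hV, hdown V hV hVle hVne⟩
    · rintro ⟨hV, hVs⟩
      exact ⟨hV, hVs.trans hlt.le, fun hVe => absurd (hVe ▸ hVs) (not_le.2 hlt)⟩

/-! ## §2 The FAR regime `d ≤ c + e`: every term is `ω(α₁)` -/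

/-- **THE FAR REGIME — «A ONE-CLASS CELL».**  Ramified quadratic datum on a complete `K`; `α₁, γ₁` fixed with `|α₁| = 1`, `|γ₁| = |ϖ|^{2c}`; `d ≤ c + e`; `S` ANY finite set of fixed
digits in the ball `|V| ≤ |ϖ|^{2e}`.  THEN every value `α₁ + γ₁V` lies in `α₁·U_F(2d)` (`|γ₁V| ≤ |ϖ|^{2(c+e)} ≤ |ϖ|^{2d}`), so `ω(α₁ + γ₁V) = ω(α₁)` (★ Lit `normSign_eq_of_near`) and
**`Σ_{V ∈ S} ω(α₁ + γ₁·V) = #S · ω(α₁)`**. [cite: Serre1979, Ch. XV §2; Ch. V §3 Cor. 3 pp. 84–86] -/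
theorem sum_normSign_affine_eq_card_mul_of_far [CompleteSpace K] (hD : IsRamifiedQuadraticDatum σ ϖ d t)
    {α₁ γ₁ : K} (hσα₁ : σ α₁ = α₁) (hα₁ : Valued.v α₁ = 1) (hσγ₁ : σ γ₁ = γ₁) {c e : ℕ} (hγ₁ : Valued.v γ₁ = Valued.v ϖ ^ (2 * c)) (hfar : d ≤ c + e)
    (S : Finset K) (hS : ∀ V ∈ S, σ V = V ∧ Valued.v V ≤ Valued.v ϖ ^ (2 * e)) :
    ∑ V ∈ S, normSign σ (α₁ + γ₁ * V) = (S.card : ℤ) * normSign σ α₁ := by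
  obtain ⟨-, -, hϖ, -, -, -, -⟩ := id hD
  have hϖ1 : Valued.v ϖ ≤ 1 := by rw [hϖ, ← exp_zero, exp_le_exp]; norm_num
  have hterm : ∀ V ∈ S, normSign σ (α₁ + γ₁ * V) = normSign σ α₁ := by
    intro V hV
    obtain ⟨hσV, hVe⟩ := hS V hV
    refine normSign_eq_of_near hD hσα₁ (by rw [map_add, map_mul, hσα₁, hσγ₁, hσV]) hα₁ (n := 2 * d) (by omega) ?_
    rw [show α₁ - (α₁ + γ₁ * V) = -(γ₁ * V) by ring, Valuation.map_neg, map_mul, hγ₁]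
    calc Valued.v ϖ ^ (2 * c) * Valued.v V ≤ Valued.v ϖ ^ (2 * c) * Valued.v ϖ ^ (2 * e) := mul_le_mul' le_rfl hVe
      _ = Valued.v ϖ ^ (2 * (c + e)) := by rw [← pow_add]; ring_nf
      _ ≤ Valued.v ϖ ^ (2 * d) := pow_le_pow_right_of_le_one' hϖ1 (by omega)
  rw [sum_congr rfl hterm, sum_const, nsmul_eq_mul]

/-- **FAR REGIME, BALL FORM**: `Σ_{V ∈ Rd.filter (|V| ≤ |ϖ|^{2e})} ω(α₁ + γ₁·V) = #(Rd.filter (|V| ≤ |ϖ|^{2e})) · ω(α₁)` for `d ≤ c + e` (`Rd` any finite set of fixed digits).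
[cite: Serre1979, Ch. XV §2] -/
theorem sum_normSign_affine_filterBall_eq_card_mul_of_far [CompleteSpace K] (hD : IsRamifiedQuadraticDatum σ ϖ d t)
    {α₁ γ₁ : K} (hσα₁ : σ α₁ = α₁) (hα₁ : Valued.v α₁ = 1) (hσγ₁ : σ γ₁ = γ₁) {c e : ℕ} (hγ₁ : Valued.v γ₁ = Valued.v ϖ ^ (2 * c)) (hfar : d ≤ c + e)
    (Rd : Finset K) (hRdσ : ∀ V ∈ Rd, σ V = V) :
    ∑ V ∈ Rd.filter (fun V => Valued.v V ≤ Valued.v ϖ ^ (2 * e)), normSign σ (α₁ + γ₁ * V) =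
      ((Rd.filter (fun V => Valued.v V ≤ Valued.v ϖ ^ (2 * e))).card : ℤ) * normSign σ α₁ :=
  sum_normSign_affine_eq_card_mul_of_far hD hσα₁ hα₁ hσγ₁ hγ₁ hfar _ fun V hV =>
    ⟨hRdσ V (mem_filter.1 hV).1, (mem_filter.1 hV).2⟩

/-- **FAR REGIME, SPHERE FORM**: `Σ_{V ∈ Rd.filter (|V| = |ϖ|^{2e})} ω(α₁ + γ₁·V) = #(Rd.filter (|V| = |ϖ|^{2e})) · ω(α₁)` for `d ≤ c + e` — a FAR cell is ONE-CLASS.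
[cite: Serre1979, Ch. XV §2] [cite: Kottwitz1986BaseChangeUnits, §1 pp. 240–241] -/
theorem sum_normSign_affine_filterSphere_eq_card_mul_of_far [CompleteSpace K] (hD : IsRamifiedQuadraticDatum σ ϖ d t)
    {α₁ γ₁ : K} (hσα₁ : σ α₁ = α₁) (hα₁ : Valued.v α₁ = 1) (hσγ₁ : σ γ₁ = γ₁) {c e : ℕ} (hγ₁ : Valued.v γ₁ = Valued.v ϖ ^ (2 * c)) (hfar : d ≤ c + e)
    (Rd : Finset K) (hRdσ : ∀ V ∈ Rd, σ V = V) :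
    ∑ V ∈ Rd.filter (fun V => Valued.v V = Valued.v ϖ ^ (2 * e)), normSign σ (α₁ + γ₁ * V) =
      ((Rd.filter (fun V => Valued.v V = Valued.v ϖ ^ (2 * e))).card : ℤ) * normSign σ α₁ :=
  sum_normSign_affine_eq_card_mul_of_far hD hσα₁ hα₁ hσγ₁ hγ₁ hfar _ fun V hV =>
    ⟨hRdσ V (mem_filter.1 hV).1, (mem_filter.1 hV).2.le⟩

/-! ## §3 The ZERO regime `1 ≤ c + e`, `c + e + 2 ≤ d`: a BALANCED sphere -/

/-- **THE ZERO REGIME — «A BALANCED CELL»: `Σ_{V ∈ Rd.filter (|V| = |ϖ|^{2e})} ω(α₁ + γ₁·V) = 0`.**  Ramified quadratic datum on a complete `K` with finite residue field, `|2| < 1`;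
`α₁, γ₁` fixed, `|α₁| = 1`, `|γ₁| = |ϖ|^{2c}`; `1 ≤ c + e` and `c + e + 2 ≤ d` (the image sphere `|u − α₁| = |ϖ|^{2(c+e)}` lies strictly inside `α₁`'s unit level and TWO levels
above the conductor); resolution `n` with `2d − 1 ≤ 2c + n` and `2(e + 1) ≤ n`; `Rd` ONE complete irredundant system of σ-fixed integral digits modulo `|ϖ|^n` (`hRd1 hRd2 hRd3`).
PROOF: the ball sums at `e` and at `e + 1` vanish (★ p864489 §3) and §1 splits. [cite: Serre1979, Ch. V §3 Cor. 3 pp. 84–86; Ch. XV §2] [cite: NeukirchANT1999, Ch. V (1.3)]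
[cite: Kottwitz1986BaseChangeUnits, §1 pp. 240–241] [cite: Rogawski1990, §4.9 Prop. 4.9.1 (b) p. 55] -/
theorem sum_normSign_affine_filterSphere_eq_zero [CompleteSpace K] [Finite 𝓀[K]] (hD : IsRamifiedQuadraticDatum σ ϖ d t) (h2v : Valued.v (2 : K) < 1)
    {α₁ γ₁ : K} (hσα₁ : σ α₁ = α₁) (hα₁ : Valued.v α₁ = 1) (hσγ₁ : σ γ₁ = γ₁) {c e : ℕ} (hγ₁ : Valued.v γ₁ = Valued.v ϖ ^ (2 * c))
    (hs1 : 1 ≤ c + e) (hsd : c + e + 2 ≤ d) {n : ℕ} (hn : 2 * d - 1 ≤ 2 * c + n) (hne : 2 * (e + 1) ≤ n)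
    (Rd : Finset K) (hRd1 : ∀ V ∈ Rd, σ V = V ∧ Valued.v V ≤ 1)
    (hRd2 : ∀ V : K, σ V = V → Valued.v V ≤ 1 → ∃ V₀ ∈ Rd, Valued.v (V - V₀) ≤ Valued.v ϖ ^ n)
    (hRd3 : ∀ V ∈ Rd, ∀ V' ∈ Rd, Valued.v (V - V') ≤ Valued.v ϖ ^ n → V = V') :
    ∑ V ∈ Rd.filter (fun V => Valued.v V = Valued.v ϖ ^ (2 * e)), normSign σ (α₁ + γ₁ * V) = 0 := by
  have hball := sum_normSign_affine_filterBall_eq_zero hD h2v hσα₁ hα₁ hσγ₁ hγ₁ hs1 (by omega) hn Rd hRd1 hRd2 hRd3 (by omega)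
  have hball' := sum_normSign_affine_filterBall_eq_zero hD h2v hσα₁ hα₁ hσγ₁ hγ₁ (e := e + 1) (by omega) (by omega) hn Rd hRd1 hRd2 hRd3 hne
  rw [sum_filterBall_eq_sum_filterSphere_add_sum_filterBall_succ hD Rd (fun V hV => (hRd1 V hV).1) e, hball', add_zero] at hball
  exact hball

/-! ## §4 The CONDUCTOR sphere `c + e + 1 = d`: the FLIP cell -/

/-- **THE CONDUCTOR SPHERE — «THE FLIP CELL»: `Σ_{V ∈ Rd.filter (|V| = |ϖ|^{2e})} ω(α₁ + γ₁·V) = −(#(Rd.filter (|V| ≤ |ϖ|^{2(e+1)})) · ω(α₁))`.**  Ramified quadratic datum on a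
complete `K` with finite residue field, `|2| < 1`; `α₁, γ₁` fixed, `|α₁| = 1`, `|γ₁| = |ϖ|^{2c}`; `c + e + 1 = d` (the image sphere is the shell `α₁·(U_F(2d−2) ∖ U_F(2d))` right
above the conductor); resolution `2d − 1 ≤ 2c + n`, `2e ≤ n`; `Rd` ONE complete irredundant system of σ-fixed integral digits modulo `|ϖ|^n`.  PROOF: the ball at `e` sums to `0`
(★ p864489 §3; `1 ≤ c + e` from `2 ≤ d` at a wild place, ★ Lit `two_le_of_v_two_lt_one`), the inner ball at `e + 1` is FAR (§2: `#·ω(α₁)`), and §1 splits.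
[cite: Serre1979, Ch. V §3 Cor. 3 pp. 84–86; Ch. XV §2] [cite: NeukirchANT1999, Ch. V (1.3)] [cite: Kottwitz1986BaseChangeUnits, §1 pp. 240–241]
[cite: Rogawski1990, §4.9 Prop. 4.9.1 (b) p. 55] -/
theorem sum_normSign_affine_filterSphere_conductor [CompleteSpace K] [Finite 𝓀[K]] (hD : IsRamifiedQuadraticDatum σ ϖ d t) (h2v : Valued.v (2 : K) < 1)
    {α₁ γ₁ : K} (hσα₁ : σ α₁ = α₁) (hα₁ : Valued.v α₁ = 1) (hσγ₁ : σ γ₁ = γ₁) {c e : ℕ} (hγ₁ : Valued.v γ₁ = Valued.v ϖ ^ (2 * c))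
    (hcond : c + e + 1 = d) {n : ℕ} (hn : 2 * d - 1 ≤ 2 * c + n) (hne : 2 * e ≤ n)
    (Rd : Finset K) (hRd1 : ∀ V ∈ Rd, σ V = V ∧ Valued.v V ≤ 1)
    (hRd2 : ∀ V : K, σ V = V → Valued.v V ≤ 1 → ∃ V₀ ∈ Rd, Valued.v (V - V₀) ≤ Valued.v ϖ ^ n)
    (hRd3 : ∀ V ∈ Rd, ∀ V' ∈ Rd, Valued.v (V - V') ≤ Valued.v ϖ ^ n → V = V') :
    ∑ V ∈ Rd.filter (fun V => Valued.v V = Valued.v ϖ ^ (2 * e)), normSign σ (α₁ + γ₁ * V) =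
      -(((Rd.filter (fun V => Valued.v V ≤ Valued.v ϖ ^ (2 * (e + 1)))).card : ℤ) * normSign σ α₁) := by
  obtain ⟨hσ, hvσ, hϖ, hfix, hd, -, ht⟩ := id hD
  have h2d : 2 ≤ d := two_le_of_v_two_lt_one hσ hvσ hfix hϖ hd ht h2v
  have hball := sum_normSign_affine_filterBall_eq_zero hD h2v hσα₁ hα₁ hσγ₁ hγ₁ (e := e) (by omega) (by omega) hn Rd hRd1 hRd2 hRd3 hne
  have hinner := sum_normSign_affine_filterBall_eq_card_mul_of_far hD hσα₁ hα₁ hσγ₁ hγ₁ (e := e + 1) (by omega) Rd (fun V hV => (hRd1 V hV).1)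
  rw [sum_filterBall_eq_sum_filterSphere_add_sum_filterBall_succ hD Rd (fun V hV => (hRd1 V hV).1) e, hinner] at hball
  linarith

/-! ## §5 PART B — the VALUE (cancellation) sphere: centre INSIDE the digit ball, `|α₁| ≤ |γ₁| = |ϖ|^{2c}` -/

/-- **(B1) THE AFFINE CHANGE OF DIGITS WHEN THE CENTRE LIES INSIDE THE DIGIT BALL.**  `α₁, γ₁` fixed with `|α₁| ≤ |ϖ|^{2c}`, `|γ₁| = |ϖ|^{2c}`; `Rd` ONE complete irredundant system of
σ-fixed integral digits modulo `|ϖ|^n`.  THEN the values `W := α₁ + γ₁·V`, `V ∈ Rd`, are σ-fixed elements of the ball `|W| ≤ |ϖ|^{2c}`, COMPLETE for the fixed elements of that ball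
modulo `|ϖ|^{2c+n}` and IRREDUNDANT modulo `|ϖ|^{2c+n}` — `|γ₁|`'s exponent is absorbed in the resolution (datum: `|ϖ| = exp(−1)` only).
[cite: Serre1979, Ch. V §3 Prop. 5 pp. 84–86] [cite: Kottwitz1986BaseChangeUnits, §1 pp. 240–241] -/
theorem affine_image_repr_valueBall (hD : IsRamifiedQuadraticDatum σ ϖ d t)
    {α₁ γ₁ : K} (hσα₁ : σ α₁ = α₁) (hσγ₁ : σ γ₁ = γ₁) {c : ℕ} (hα₁ : Valued.v α₁ ≤ Valued.v ϖ ^ (2 * c)) (hγ₁ : Valued.v γ₁ = Valued.v ϖ ^ (2 * c))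
    {n : ℕ} (Rd : Finset K) (hRd1 : ∀ V ∈ Rd, σ V = V ∧ Valued.v V ≤ 1)
    (hRd2 : ∀ V : K, σ V = V → Valued.v V ≤ 1 → ∃ V₀ ∈ Rd, Valued.v (V - V₀) ≤ Valued.v ϖ ^ n)
    (hRd3 : ∀ V ∈ Rd, ∀ V' ∈ Rd, Valued.v (V - V') ≤ Valued.v ϖ ^ n → V = V') :
    (∀ V ∈ Rd, σ (α₁ + γ₁ * V) = α₁ + γ₁ * V ∧ Valued.v (α₁ + γ₁ * V) ≤ Valued.v ϖ ^ (2 * c)) ∧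
    (∀ W : K, σ W = W → Valued.v W ≤ Valued.v ϖ ^ (2 * c) → ∃ V₀ ∈ Rd, Valued.v (W - (α₁ + γ₁ * V₀)) ≤ Valued.v ϖ ^ (2 * c + n)) ∧
    (∀ V ∈ Rd, ∀ V' ∈ Rd, Valued.v ((α₁ + γ₁ * V) - (α₁ + γ₁ * V')) ≤ Valued.v ϖ ^ (2 * c + n) → V = V') := by
  obtain ⟨-, -, hϖ, -, -, -, -⟩ := id hD
  have hvϖ0 : Valued.v ϖ ≠ 0 := by rw [hϖ]; exact exp_ne_zero
  have hγv0 : Valued.v γ₁ ≠ 0 := by rw [hγ₁]; exact pow_ne_zero _ hvϖ0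
  have hγ0 : γ₁ ≠ 0 := fun h => hγv0 (by rw [h, map_zero])
  have hγpos : 0 < Valued.v γ₁ := zero_lt_iff.2 hγv0
  refine ⟨fun V hV => ⟨by rw [map_add, map_mul, hσα₁, hσγ₁, (hRd1 V hV).1], ?_⟩, fun W hσW hW => ?_, fun V hV V' hV' hVV => ?_⟩
  · refine (Valuation.map_add _ _ _).trans (max_le hα₁ ?_)
    rw [map_mul, hγ₁]
    exact mul_le_of_le_one_right' (hRd1 V hV).2
  · -- the coordinate `u := (W − α₁) ∕ γ₁` is a fixed integral element
    set u : K := (W - α₁) * γ₁⁻¹ with hu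
    have hσu : σ u = u := by rw [hu, map_mul, map_inv₀, map_sub, hσW, hσα₁, hσγ₁]
    have hγu : γ₁ * u = W - α₁ := by rw [hu, mul_comm, mul_assoc, inv_mul_cancel₀ hγ0, mul_one]
    have hu1 : Valued.v u ≤ 1 := by
      have h1 : Valued.v γ₁ * Valued.v u ≤ Valued.v γ₁ * 1 := by
        rw [← map_mul, hγu, mul_one, hγ₁]
        exact (Valuation.map_sub _ _ _).trans (max_le hW hα₁)
      exact (mul_le_mul_iff_right₀ hγpos).1 h1
    obtain ⟨V₀, hV₀R, hV₀⟩ := hRd2 u hσu hu1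
    refine ⟨V₀, hV₀R, ?_⟩
    rw [show W - (α₁ + γ₁ * V₀) = γ₁ * (u - V₀) by rw [mul_sub, hγu]; ring, map_mul, hγ₁, pow_add]
    exact mul_le_mul' le_rfl hV₀
  · apply hRd3 V hV V' hV'
    have e1 : α₁ + γ₁ * V - (α₁ + γ₁ * V') = γ₁ * (V - V') := by ring
    rw [e1, map_mul, pow_add, ← hγ₁] at hVV
    exact (mul_le_mul_iff_right₀ hγpos).1 hVV

/-- **(B2) «THE VALUE-SPHERE SUM VANISHES AT FINE RESOLUTION».**  Ramified quadratic datum on a complete `K` with finite residue field, `|2| < 1`; `α₁, γ₁` fixed with `|α₁| ≤ |ϖ|^{2c}`,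
`|γ₁| = |ϖ|^{2c}` (centre INSIDE the digit ball — non-unit allowed; the image of the digit ball is the 0-centred ball `|W| ≤ |ϖ|^{2c}`, on which `|α₁ + γ₁V| < max(|α₁|, |γ₁V|)` may occur:
a CANCELLATION sphere); ANY value level `ℓ`; a resolution `n` whose RELATIVE resolution on the value sphere reaches the conductor: `2d − 1 + 2ℓ ≤ 2c + n`; `Rd` ONE complete irredundant
system of σ-fixed integral digits modulo `|ϖ|^n`.  THEN **`Σ_{V ∈ Rd.filter (fun V => |α₁ + γ₁·V| = |ϖ|^{2ℓ})} normSign σ (α₁ + γ₁·V) = 0`**: the values on the sphere, read on their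
unit parts `W·ϖ_F^{−ℓ}` (§0: same `ω`), form a complete irredundant system of representatives of ALL fixed units modulo `𝔭^{2c+n−2ℓ}` ((B1)), a `U_F(2d−2)`-stable set, and ★ Lit
`sum_normSign_repr_eq_zero` applies (for `ℓ < c` the sphere misses the ball and the filter is empty).  BOUNDARY: for `2c + n − 2ℓ ≤ 2d − 2` the sum over a representative system is NOT
determined by the data (no one-field statement exists there). [cite: Serre1979, Ch. V §3 Cor. 3 pp. 84–86; Ch. XV §2] [cite: NeukirchANT1999, Ch. V (1.3)]
[cite: Kottwitz1986BaseChangeUnits, §1 pp. 240–241] [cite: Rogawski1990, §4.9 Prop. 4.9.1 (b) p. 55] -/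
theorem sum_normSign_affine_filterValueSphere_eq_zero [CompleteSpace K] [Finite 𝓀[K]] (hD : IsRamifiedQuadraticDatum σ ϖ d t) (h2v : Valued.v (2 : K) < 1)
    {α₁ γ₁ : K} (hσα₁ : σ α₁ = α₁) (hσγ₁ : σ γ₁ = γ₁) {c : ℕ} (hα₁ : Valued.v α₁ ≤ Valued.v ϖ ^ (2 * c)) (hγ₁ : Valued.v γ₁ = Valued.v ϖ ^ (2 * c))
    {ℓ n : ℕ} (hfloor : 2 * d - 1 + 2 * ℓ ≤ 2 * c + n)
    (Rd : Finset K) (hRd1 : ∀ V ∈ Rd, σ V = V ∧ Valued.v V ≤ 1)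
    (hRd2 : ∀ V : K, σ V = V → Valued.v V ≤ 1 → ∃ V₀ ∈ Rd, Valued.v (V - V₀) ≤ Valued.v ϖ ^ n)
    (hRd3 : ∀ V ∈ Rd, ∀ V' ∈ Rd, Valued.v (V - V') ≤ Valued.v ϖ ^ n → V = V') :
    ∑ V ∈ Rd.filter (fun V => Valued.v (α₁ + γ₁ * V) = Valued.v ϖ ^ (2 * ℓ)), normSign σ (α₁ + γ₁ * V) = 0 := by
  classical
  obtain ⟨hσ, hvσ, hϖ, -, -, hd1, -⟩ := id hD
  have hpow : ∀ k : ℕ, Valued.v ϖ ^ k = exp (-(k : ℤ)) := fun k => by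
    rw [hϖ, ← exp_nsmul, nsmul_eq_mul, mul_neg, mul_one]
  have hvϖ0 : Valued.v ϖ ≠ 0 := by rw [hϖ]; exact exp_ne_zero
  have hϖ0 : ϖ ≠ 0 := fun h => hvϖ0 (by rw [h, map_zero])
  have hϖ1 : Valued.v ϖ ≤ 1 := by rw [hϖ, ← exp_zero, exp_le_exp]; norm_num
  obtain ⟨hB1, hB2, hB3⟩ := affine_image_repr_valueBall hD hσα₁ hσγ₁ hα₁ hγ₁ (n := n) Rd hRd1 hRd2 hRd3
  -- the sphere misses the ball when `ℓ < c`
  by_cases hℓc : ℓ < c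
  · have hlt : Valued.v ϖ ^ (2 * c) < Valued.v ϖ ^ (2 * ℓ) := by rw [hpow, hpow, exp_lt_exp]; omega
    rw [Finset.filter_false_of_mem (fun V hV => ?_), sum_empty]
    exact ne_of_lt ((hB1 V hV).2.trans_lt hlt)
  rw [not_lt] at hℓc
  -- the relative resolution `ρ = 2c + n − 2ℓ ≥ 2d − 1`
  obtain ⟨ρ, hρ, hρeq⟩ : ∃ ρ : ℕ, 2 * d - 1 ≤ ρ ∧ 2 * c + n = 2 * ℓ + ρ := ⟨2 * c + n - 2 * ℓ, by omega, by omega⟩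
  -- letters of `π := ϖ_F = ϖσϖ`
  have hσπ : σ ((ϖ * σ ϖ) ^ ℓ) = (ϖ * σ ϖ) ^ ℓ := by rw [map_pow, map_mul, hσ, mul_comm (σ ϖ) ϖ]
  have hvπ : Valued.v ((ϖ * σ ϖ) ^ ℓ) = Valued.v ϖ ^ (2 * ℓ) := by rw [map_pow, map_mul, hvσ, ← pow_two, ← pow_mul]
  have h2ℓ0 : Valued.v ϖ ^ (2 * ℓ) ≠ 0 := pow_ne_zero _ hvϖ0
  have h2ℓpos : 0 < Valued.v ϖ ^ (2 * ℓ) := zero_lt_iff.2 h2ℓ0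
  have hπ0 : (ϖ * σ ϖ) ^ ℓ ≠ 0 := fun h => h2ℓ0 (by rw [← hvπ, h, map_zero])
  have hγv0 : Valued.v γ₁ ≠ 0 := by rw [hγ₁]; exact pow_ne_zero _ hvϖ0
  have hγ0 : γ₁ ≠ 0 := fun h => hγv0 (by rw [h, map_zero])
  have hγpos : 0 < Valued.v γ₁ := zero_lt_iff.2 hγv0
  -- `|ϖ|^{2c+n} < |ϖ|^{2ℓ}` (the resolution is finer than the sphere)
  have hres : Valued.v ϖ ^ (2 * c + n) < Valued.v ϖ ^ (2 * ℓ) := by rw [hpow, hpow, exp_lt_exp]; omega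
  -- the set of all fixed units
  set A : Set K := {u | σ u = u ∧ Valued.v u = 1} with hAdef
  have hAu : ∀ f ∈ A, σ f = f ∧ Valued.v f = 1 := fun f hf => hf
  have hAst : ∀ f ∈ A, ∀ a : K, σ a = a → Valued.v a = 1 → Valued.v (a - 1) ≤ exp (-(2 * ((d - 1 : ℕ) : ℤ))) → a * f ∈ A := by
    rintro f ⟨hσf, hf⟩ a hσa ha1 -
    exact ⟨by rw [map_mul, hσa, hσf], by rw [map_mul, ha1, hf, mul_one]⟩
  -- the representative map: the unit part of the value
  let g : K → K := fun V => (α₁ + γ₁ * V) * ((ϖ * σ ϖ) ^ ℓ)⁻¹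
  set D : Finset K := Rd.filter (fun V => Valued.v (α₁ + γ₁ * V) = Valued.v ϖ ^ (2 * ℓ)) with hDdef
  have hg_inj : Set.InjOn g ↑D := by
    intro a _ a' _ h
    have h' : (α₁ + γ₁ * a) * ((ϖ * σ ϖ) ^ ℓ)⁻¹ = (α₁ + γ₁ * a') * ((ϖ * σ ϖ) ^ ℓ)⁻¹ := h
    exact mul_left_cancel₀ hγ0 (add_left_cancel (mul_right_cancel₀ (inv_ne_zero hπ0) h'))
  set S : Finset K := D.image g with hSdef
  have hS1 : ∀ y ∈ S, y ∈ A := by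
    intro y hy
    obtain ⟨V, hV, rfl⟩ := mem_image.1 hy
    obtain ⟨hVR, hVℓ⟩ := mem_filter.1 hV
    refine ⟨by simp only [g, map_mul, map_inv₀, map_add, hσα₁, hσγ₁, hσπ, (hRd1 V hVR).1], ?_⟩
    simp only [g, map_mul, map_inv₀, hvπ, hVℓ, mul_inv_cancel₀ h2ℓ0]
  have hS2 : ∀ f ∈ A, ∃ y ∈ S, Valued.v (f - y) ≤ Valued.v ϖ ^ ρ := by
    rintro f ⟨hσf, hf⟩
    -- `W := f·ϖ_F^ℓ` lies on the value sphere, inside the ball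
    set W : K := f * (ϖ * σ ϖ) ^ ℓ with hW
    have hσW : σ W = W := by rw [hW, map_mul, hσf, hσπ]
    have hvW : Valued.v W = Valued.v ϖ ^ (2 * ℓ) := by rw [hW, map_mul, hf, hvπ, one_mul]
    have hWc : Valued.v W ≤ Valued.v ϖ ^ (2 * c) := by rw [hvW]; exact pow_le_pow_right_of_le_one' hϖ1 (by omega)
    obtain ⟨V₀, hV₀R, hV₀⟩ := hB2 W hσW hWc
    -- the representative value lies on the same sphere
    have hnear : Valued.v (W - (α₁ + γ₁ * V₀)) < Valued.v W := by rw [hvW]; exact hV₀.trans_lt hres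
    have hW₀ : Valued.v (α₁ + γ₁ * V₀) = Valued.v ϖ ^ (2 * ℓ) := by
      rw [← hvW, show α₁ + γ₁ * V₀ = W + -(W - (α₁ + γ₁ * V₀)) by ring]
      exact Valuation.map_add_eq_of_lt_left _ (by rwa [Valuation.map_neg])
    refine ⟨g V₀, mem_image.2 ⟨V₀, mem_filter.2 ⟨hV₀R, hW₀⟩, rfl⟩, ?_⟩
    have e1 : f - g V₀ = (W - (α₁ + γ₁ * V₀)) * ((ϖ * σ ϖ) ^ ℓ)⁻¹ := by
      simp only [g, hW]; rw [sub_mul, mul_assoc, mul_inv_cancel₀ hπ0, mul_one]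
    rw [e1, map_mul, map_inv₀, hvπ]
    calc Valued.v (W - (α₁ + γ₁ * V₀)) * (Valued.v ϖ ^ (2 * ℓ))⁻¹
        ≤ Valued.v ϖ ^ (2 * c + n) * (Valued.v ϖ ^ (2 * ℓ))⁻¹ := mul_le_mul' hV₀ le_rfl
      _ = Valued.v ϖ ^ ρ := by rw [hρeq, pow_add, mul_comm (Valued.v ϖ ^ (2 * ℓ)), mul_assoc, mul_inv_cancel₀ h2ℓ0, mul_one]
  have hS3 : ∀ y ∈ S, ∀ y' ∈ S, Valued.v (y - y') ≤ Valued.v ϖ ^ ρ → y = y' := by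
    intro y hy y' hy' hyy
    obtain ⟨V, hV, rfl⟩ := mem_image.1 hy
    obtain ⟨V', hV', rfl⟩ := mem_image.1 hy'
    have e1 : g V - g V' = (α₁ + γ₁ * V - (α₁ + γ₁ * V')) * ((ϖ * σ ϖ) ^ ℓ)⁻¹ := by simp only [g]; ring
    rw [e1, map_mul, map_inv₀, hvπ, mul_inv_le_iff₀ h2ℓpos, ← pow_add, add_comm ρ, ← hρeq] at hyy
    rw [hB3 V (mem_filter.1 hV).1 V' (mem_filter.1 hV').1 hyy]
  have h0 := sum_normSign_repr_eq_zero hD h2v hρ hAu hAst S hS1 hS2 hS3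
  rw [hSdef, sum_image hg_inj] at h0
  rw [← h0]
  exact sum_congr rfl fun V _ => (normSign_mul_varpiF_pow_inv hϖ0 ℓ (α₁ + γ₁ * V)).symm

end Summit.HodgeConjecture.HodgeConjecture.Cruxes.H413.F0P3cDyRamSphereLabelSums

end
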